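import Summits.QuantumFields.YangMills.Theorems.ConvexGribovBodyContinuumLegGivenGapCsclRep
import HarnessLib

/-!
# `ContinuumLegGivenGap` (stmt-QuantumFields-15828), line `Sketch`, reshape 17-CS, helper 10 of `stub_csclOfLock`:
# the representative as a complex cylinder observable; exact lattice translation; the class condition from supports

Sequel of `…CsclRep`: `cscl_rep_cylinderData` (measurable, bounded, cylinder on the class box `Λ`, and `Λ` has times in
`[1, Nk + Rc]`), `cscl_rep_translate` (`X_{T_{a s e₀}H} = X_H ∘ τˢ` when the translated time support fits the box),
`cscl_cls_of_tsupport` (tuples carrying the lattice sum of a test function supported in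
`{δ ≤ xᵢ₀ ≤ T₀, |xᵢⱼ| ≤ Rsp}` have `|xᵢⱼ| ≤ Nk`, `xᵢ₀ ≥ Rc + 2` once `a (Rc+2) ≤ δ`, `Rsp ≤ a Nk`, `T₀ ≤ a Nk`).
Registered anchor: `cscl_anchor_repB`. No definitions. [folklore]
-/

noncomputable section

open scoped SchwartzMap ComplexConjugate
open MeasureTheory Filter Topology
open Literature.MathematicalPhysics.QuantumFieldTheory Literature.MathematicalPhysics.QuantumLattice
  Literature.MathematicalPhysics.AQFT
open Literature.Probability.LatticeModels (box mem_box Site)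
open Summit.QuantumFields.YangMills.Theorems.ClusteringToYangMills.Reconstructible
open Summit.QuantumFields.YangMills.Cruxes.ContinuumLimitOnTrajectory.TwoOrbitSynchronisation (Arp.sum_boxFun_eq)

namespace Summit.QuantumFields.YangMills.Theorems.ContinuumLegGivenGap

section RepB

variable {G : Type} [Group G] [TopologicalSpace G] [IsTopologicalGroup G] [CompactSpace G]
  [MeasurableSpace G] [BorelSpace G] (r : LatticeRep G) (sch : SpeciesScheme (YMSpecies G)) (k : ℕ)

omit [TopologicalSpace G] [IsTopologicalGroup G] [CompactSpace G] [BorelSpace G] in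
/-- **Cylinder data of a complex observable with real local parts**: measurable, bounded, a cylinder on the common
support; and the class box has times in `[1, Nk + Rc]`. [folklore] -/
theorem cscl_rep_cylinderData {Nk Rc : ℕ} {X : LGConfig 4 G → ℂ} (O₁ O₂ : YMSpecies G)
    (h1 : O₁.supp = ((box 4 (Nk + Rc)).filter fun y => 1 ≤ y 0) ×ˢ (Finset.univ : Finset (Fin 4)))
    (h2 : O₂.supp = ((box 4 (Nk + Rc)).filter fun y => 1 ≤ y 0) ×ˢ (Finset.univ : Finset (Fin 4)))
    (hX : ∀ V, X V = (O₁.F V : ℂ) + Complex.I * (O₂.F V : ℂ)) :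
    Measurable X ∧ (∃ C : ℝ, ∀ U, ‖X U‖ ≤ C) ∧
      IsCylinder X (((box 4 (Nk + Rc)).filter fun y => 1 ≤ y 0) ×ˢ (Finset.univ : Finset (Fin 4))) ∧
      ∀ e ∈ ((box 4 (Nk + Rc)).filter fun y => 1 ≤ y 0) ×ˢ (Finset.univ : Finset (Fin 4)),
        (1 : ℤ) ≤ e.1 0 ∧ e.1 0 ≤ ((Nk + Rc : ℕ) : ℤ) := by
  have hXf : X = fun V => (O₁.F V : ℂ) + Complex.I * (O₂.F V : ℂ) := funext hX
  obtain ⟨C1, hC1⟩ := O₁.bounded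
  obtain ⟨C2, hC2⟩ := O₂.bounded
  refine ⟨?_, ⟨C1 + C2, fun U => ?_⟩, ?_, fun e he => ?_⟩
  · rw [hXf]
    exact (Complex.continuous_ofReal.measurable.comp O₁.measurable).add
      ((Complex.continuous_ofReal.measurable.comp O₂.measurable).const_mul _)
  · rw [hX]
    refine (norm_add_le _ _).trans (add_le_add ?_ ?_)
    · rw [Complex.norm_real, Real.norm_eq_abs]; exact hC1 U
    · rw [norm_mul, Complex.norm_I, one_mul, Complex.norm_real, Real.norm_eq_abs]; exact hC2 U
  · intro U V hUV
    rw [hX, hX]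
    have e1 : O₁.F U = O₁.F V := O₁.isCylinder (by rw [h1]; exact hUV)
    have e2 : O₂.F U = O₂.F V := O₂.isCylinder (by rw [h2]; exact hUV)
    rw [e1, e2]
  · simp only [Finset.mem_product, Finset.mem_filter, mem_box, Finset.mem_univ, and_true] at he
    obtain ⟨hb, ht⟩ := he
    have := (hb 0).2
    constructor <;> omega

omit [TopologicalSpace G] [IsTopologicalGroup G] [CompactSpace G] [BorelSpace G] in
/-- **Exact lattice translation of the representative**: `X_{T_{a s e₀}H}(V) = X_H(τˢ V)` for `H` supported at times
of modulus `≤ T` with `T + a (s + 1) ≤ a L`. [folklore] -/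
theorem cscl_rep_translate {m : ℕ} (H : 𝓢((Fin m → EuclideanSpace ℝ (Fin 4)), ℂ)) {T : ℝ} (sN : ℕ)
    (hH : ∀ x, H x ≠ 0 → ∀ i, |x i 0| ≤ T) (hfit : T + sch.a k * (sN + 1) ≤ sch.a k * sch.L k) (mb : ℝ)
    (P : LGConfig 4 G → ℝ) (V : LGConfig 4 G) :
    (∑ x : Fin m → ↥(box 4 (sch.L k)),
        translateMulti (EuclideanSpace.single 0 (sch.a k * sN)) H (fun i => sch.a k • siteToE (↑(x i) : Site 4)) *
          ∏ i, ((P (configShift (-(↑(x i) : Site 4)) V) - mb : ℝ) : ℂ)) =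
      ∑ x : Fin m → ↥(box 4 (sch.L k)), H (fun i => sch.a k • siteToE (↑(x i) : Site 4)) *
        ∏ i, ((P (configShift (-(↑(x i) : Site 4)) (configShift (-(Pi.single 0 (sN : ℤ))) V)) - mb : ℝ) : ℂ) := by
  classical
  set a : ℝ := sch.a k with ha_def
  have ha : 0 < a := sch.a_pos k
  set L := sch.L k
  set e : Site 4 := Pi.single 0 (sN : ℤ) with he
  have hsL := Arp.sum_boxFun_eq (L := L) (fun y : Fin m → Site 4 =>
    translateMulti (EuclideanSpace.single 0 (a * sN)) H (fun i => a • siteToE (y i)) *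
      ∏ i, ((P (configShift (-(y i)) V) - mb : ℝ) : ℂ))
  have hsR := Arp.sum_boxFun_eq (L := L) (fun y : Fin m → Site 4 =>
    H (fun i => a • siteToE (y i)) * ∏ i, ((P (configShift (-(y i)) (configShift (-e) V)) - mb : ℝ) : ℂ))
  simp only at hsL hsR
  rw [hsL, hsR]
  -- pointwise: translated argument and composed shifts
  have hpt : ∀ y : Fin m → Site 4,
      (fun i => a • siteToE (y i) - EuclideanSpace.single (0 : Fin 4) (a * (sN : ℝ))) =
        fun i => a • siteToE (y i - e) := by
    intro y; funext i; ext j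
    by_cases hj : j = 0
    · subst hj; simp [he, mul_sub]
    · simp [he, hj]
  have hshift : ∀ y : Site 4, configShift (-y) (configShift (-e) V) = configShift (-(y + e)) V := by
    intro y; funext q
    simp only [Literature.MathematicalPhysics.QuantumLattice.configShift_apply, neg_add, sub_neg_eq_add]
    congr 1; abel
  simp_rw [translateMulti_apply, hpt, hshift]
  -- support control: `H (a • (y - e)) ≠ 0` forces all time coordinates into the box before and after the shift
  have key : ∀ y : Fin m → Site 4, H (fun i => a • siteToE (y i)) ≠ 0 →
      ∀ i, -(L : ℤ) ≤ y i 0 ∧ y i 0 + sN ≤ L := by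
    intro y hy i
    have h1 := hH _ hy i
    simp only [PiLp.smul_apply, siteToE_apply, smul_eq_mul] at h1
    have h2 : |(y i 0 : ℝ)| * a ≤ T := by rw [abs_mul, abs_of_pos ha, mul_comm] at h1; exact h1
    have hT0 : 0 ≤ T := (by positivity : (0:ℝ) ≤ |(y i 0 : ℝ)| * a).trans h2
    have h3 : (|(y i 0 : ℝ)| + sN + 1) * a ≤ a * L := by nlinarith
    have h4 : |(y i 0 : ℝ)| + sN + 1 ≤ L := le_of_mul_le_mul_right (by nlinarith) ha
    have h5 := abs_le.1 (show |(y i 0 : ℝ)| ≤ |(y i 0 : ℝ)| from le_rfl)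
    constructor
    · have : -(L : ℝ) ≤ (y i 0 : ℝ) := by linarith [h5.1, neg_abs_le (y i 0 : ℝ)]
      exact_mod_cast this
    · have : (y i 0 : ℝ) + sN ≤ L := by linarith [le_abs_self (y i 0 : ℝ)]
      exact_mod_cast this
  have memiff : ∀ y : Fin m → Site 4, H (fun i => a • siteToE (y i)) ≠ 0 →
      (y ∈ Fintype.piFinset (fun _ : Fin m => box 4 L) ↔ (fun i => y i + e) ∈ Fintype.piFinset (fun _ : Fin m => box 4 L)) := by
    intro y hy
    simp only [Fintype.mem_piFinset, mem_box]
    refine forall_congr' fun i => forall_congr' fun j => ?_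
    by_cases hj : j = 0
    · subst hj
      obtain ⟨h0, h1⟩ := key y hy i
      simp only [Pi.add_apply, he, Pi.single_eq_same]
      omega
    · simp [he, hj]
  -- the bijection `x ↦ x - e` between the non-zero terms
  refine Finset.sum_bij_ne_zero (fun x _ _ => fun i => x i - e) (fun x hx hne => ?_)
    (fun x₁ _ _ x₂ _ _ h => ?_) (fun y hy hne => ?_) (fun x _ _ => by simp only [sub_add_cancel])
  · have hH' : H (fun i => a • siteToE (x i - e)) ≠ 0 := left_ne_zero_of_mul hne
    have := (memiff (fun i => x i - e) hH').2 (by simpa using hx)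
    exact this
  · funext i; have := congrFun h i; simpa using this
  · refine ⟨fun i => y i + e, (memiff y (left_ne_zero_of_mul hne)).1 hy, ?_, ?_⟩
    · simpa using hne
    · funext i; simp

omit [TopologicalSpace G] [IsTopologicalGroup G] [CompactSpace G] [BorelSpace G] in
/-- **The class condition from the supports.** [folklore] -/
theorem cscl_cls_of_tsupport {n : ℕ} {F : 𝓢((Fin n → EuclideanSpace ℝ (Fin 4)), ℂ)} {δ T₀ Rsp : ℝ} {Nk Rc : ℕ}
    (hF : tsupport (F : (Fin n → EuclideanSpace ℝ (Fin 4)) → ℂ) ⊆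
      {x | (∀ i, δ ≤ x i 0 ∧ x i 0 ≤ T₀) ∧ ∀ i j, |x i j| ≤ Rsp})
    (hδ : sch.a k * ((Rc : ℝ) + 2) ≤ δ) (hR : Rsp ≤ sch.a k * Nk) :
    ∀ x : Fin n → Site 4, F (fun i => sch.a k • siteToE (x i)) ≠ 0 →
      (∀ i j, |x i j| ≤ Nk) ∧ ∀ i, (Rc : ℤ) + 2 ≤ x i 0 := by
  intro x hx
  have ha : 0 < sch.a k := sch.a_pos k
  have hmem := hF (subset_tsupport _ (Function.mem_support.2 hx))
  simp only [Set.mem_setOf_eq, PiLp.smul_apply, siteToE_apply, smul_eq_mul] at hmem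
  obtain ⟨ht, hc⟩ := hmem
  refine ⟨fun i j => ?_, fun i => ?_⟩
  · have h1 := hc i j
    rw [abs_mul, abs_of_pos ha] at h1
    have h2 : (|(x i j : ℝ)|) ≤ Nk := le_of_mul_le_mul_left (h1.trans hR) ha
    have h3 : |((x i j : ℤ) : ℝ)| ≤ (Nk : ℝ) := h2
    rw [← Int.cast_abs] at h3
    exact_mod_cast h3
  · have h1 := (ht i).1
    have h2 : ((Rc : ℝ) + 2) ≤ (x i 0 : ℝ) := le_of_mul_le_mul_left (hδ.trans h1) ha
    exact_mod_cast h2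

end RepB

/-- **Registered anchor of this file** (closed elementary form, for the gate's `--supports` stub check): a point of
modulus at most `a N` in units of `a > 0` has modulus at most `N`. [folklore] -/
theorem cscl_anchor_repB :
    ∀ (a R : ℝ) (N : ℕ) (z : ℤ), 0 < a → |a * z| ≤ R → R ≤ a * N → |z| ≤ N := by
  intro a R N z ha h1 h2
  rw [abs_mul, abs_of_pos ha] at h1
  have h3 : (|(z : ℝ)|) ≤ N := le_of_mul_le_mul_left (h1.trans h2) ha
  rw [← Int.cast_abs] at h3
  exact_mod_cast h3

end Summit.QuantumFields.YangMills.Theorems.ContinuumLegGivenGap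

end
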